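import Mathlib
import Summits.ValiantsHypothesis.ValiantsHypothesis.Theorems.AlgebraicKWGamesHistoryAlternationPotential

/-!
# History-dependent algebraic KW protocols: the lexicographic count

Support lemmas for the crux `stmt-ValiantsHypothesis-10298` (`…Theses.AlgebraicKWGames.KWPerLowerBound`,
filed `--supports`), continuing `…AlgebraicKWGamesHistoryAlternationPotential`; this is the
history-dependent twin of `…BoundedAlternationLowerBoundCount` (whose `ℕ∞` bookkeeping, Horner numbers
and room lemma are reused).

The digit of block index `v` on the identified set `E` is
`dg E v = (rk (Xall ∪ Pref E v) − n²) + (rk (BE E ∪ Pref E v) − n²) ∈ [0, 2T]` (blocks counted along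
the generic run on `E`), and the potential is the base-`(2T+1)` number with digits
`dg E 0, …, dg E (Δ+1)` (most significant first).  By `HProtocol.round` one adversary round strictly
decreases the potential (`pot_lt`), so after `(2T+1)^(Δ+2)` rounds — available as soon as that many
plus one cells fit into the matrix — we reach a contradiction: `HProtocol.false_of_altBound`, no
correct protocol whose speaker alternates at most `Δ` times along every zero pattern exists.

Honest framing: a toy-model lower bound (bounded alternation, history-dependent schedule); the crux
itself (unbounded alternation) is NOT proved and nothing here bears on VP versus VNP.
-/

open MvPolynomial

-- the summit and the problem share the name `ValiantsHypothesis` (D-0017 single-conjunct layout)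
set_option linter.dupNamespace false

namespace Summit.ValiantsHypothesis.ValiantsHypothesis.Theorems.AlgebraicKWGames.OneAlt

open scoped Classical

noncomputable section

variable {n T : ℕ} {f : MvPolynomial (Cell n) ℂ} (P : HProtocol n T f)

namespace HProtocol

/-! ## The digits of the adversary -/

/-- The digit of block index `v` on `E`: the two rank measures minus their common minimum `2n²`. -/
def dg (E : Finset (Cell n)) (v : ℕ) : ℕ :=
  ((Mat n).eRk (Xall ∪ P.Pref E v)).toNat + ((Mat n).eRk (BE E ∪ P.Pref E v)).toNat -
    2 * Fintype.card (Cell n)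

/-- Bounds for both rank measures at once — Alice's (`Xall`) and Bob's (`BE E`) inputs with a prefix:
between `n²` and `n² + T`. -/
theorem eRk_measures_bounds (E : Finset (Cell n)) (v : ℕ) :
    ((Fintype.card (Cell n) : ℕ∞) ≤ (Mat n).eRk (Xall ∪ P.Pref E v) ∧
      (Mat n).eRk (Xall ∪ P.Pref E v) ≤ ((Fintype.card (Cell n) + T : ℕ) : ℕ∞)) ∧
    ((Fintype.card (Cell n) : ℕ∞) ≤ (Mat n).eRk (BE E ∪ P.Pref E v) ∧
      (Mat n).eRk (BE E ∪ P.Pref E v) ≤ ((Fintype.card (Cell n) + T : ℕ) : ℕ∞)) := by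
  have key : ∀ w : ℕ, (Fintype.card (Cell n) : ℕ∞) ≤ (Mat n).eRk (base E w ∪ P.Pref E v) ∧
      (Mat n).eRk (base E w ∪ P.Pref E v) ≤ ((Fintype.card (Cell n) + T : ℕ) : ℕ∞) := by
    intro w
    constructor
    · rw [← encard_base E w, ← (indep_base E w).eRk_eq_encard]
      exact (Mat n).eRk_mono Set.subset_union_left
    · exact ((Mat n).eRk_le_encard _).trans (P.encard_base_union_Pref_le E v w)
  constructor
  · simpa [base] using key 0
  · simpa [base] using key 1

/-- Digits are at most `2T`, i.e. digits in base `2T + 1`. -/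
theorem dg_lt (E : Finset (Cell n)) (v : ℕ) : P.dg E v < 2 * T + 1 := by
  have hA := toNat_le_of_le_coe (P.eRk_measures_bounds E v).1.2
  have hB := toNat_le_of_le_coe (P.eRk_measures_bounds E v).2.2
  unfold dg
  omega

/-- **The potential decreases.**  One adversary round (two cells to spare) produces a new cell and
decreases the base-`(2T+1)` potential with digits `dg E 0, …, dg E D`, provided every block index of a
round `< T` along every generic run is at most `D`. -/
theorem pot_lt {D : ℕ} (hD : ∀ (E : Finset (Cell n)), ∀ t < T, P.hblk E t ≤ D) (E : Finset (Cell n))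
    {e₀ : Cell n} (he₀ : e₀ ∉ E) (hroom : ∀ e, ∃ e₁, e₁ ∉ insert e E) :
    P.genOut E ∉ E ∧
      horner (2 * T + 1) (P.dg (insert (P.genOut E) E)) D < horner (2 * T + 1) (P.dg E) D := by
  obtain ⟨hnot, t₀, ht₀, hweak, hstrict⟩ := P.round E he₀ hroom
  refine ⟨hnot, ?_⟩
  set F := insert (P.genOut E) E with hF
  set N2 := Fintype.card (Cell n) with hN2
  apply horner_lt_horner (2 * T + 1) (fun v => P.dg_lt F v) D (P.hblk E t₀) (hD E t₀ ht₀)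
  · -- strict drop at `v₀ = hblk E t₀`
    obtain ⟨hwA, hwB⟩ := hweak (P.hblk E t₀) le_rfl
    obtain ⟨hAF, hBF⟩ := P.eRk_measures_bounds F (P.hblk E t₀)
    obtain ⟨hAE, hBE⟩ := P.eRk_measures_bounds E (P.hblk E t₀)
    have h1 := toNat_le_toNat_of_le hAE.2 hwA
    have h2 := toNat_le_toNat_of_le hBE.2 hwB
    have h3 := le_toNat_of_coe_le hAF.2 hAF.1
    have h4 := le_toNat_of_coe_le hBF.2 hBF.1
    by_cases hv : Even (P.hblk E t₀)
    · simp only [base, if_pos hv] at hstrict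
      have h5 := toNat_lt_toNat_of_lt hAE.2 hstrict
      unfold dg; omega
    · simp only [base, if_neg hv] at hstrict
      have h5 := toNat_lt_toNat_of_lt hBE.2 hstrict
      unfold dg; omega
  · -- weak drop before
    intro v hv
    obtain ⟨hwA, hwB⟩ := hweak v hv.le
    have h1 := toNat_le_toNat_of_le (P.eRk_measures_bounds E v).1.2 hwA
    have h2 := toNat_le_toNat_of_le (P.eRk_measures_bounds E v).2.2 hwB
    unfold dg; omega

/-! ## Iterating the adversary -/

/-- The adversary's sequence of identified sets. -/
def Eseq : ℕ → Finset (Cell n)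
  | 0 => ∅
  | i + 1 => insert (P.genOut (Eseq i)) (Eseq i)

/-- Along the adversary's sequence the potential drops by one per round while cells are to spare. -/
theorem Eseq_pot {D : ℕ} (hD : ∀ (E : Finset (Cell n)), ∀ t < T, P.hblk E t ≤ D) (K : ℕ)
    (hK : K + 1 ≤ Fintype.card (Cell n)) :
    ∀ i ≤ K, (P.Eseq i).card = i ∧
      horner (2 * T + 1) (P.dg (P.Eseq i)) D + i ≤ horner (2 * T + 1) (P.dg ∅) D := by
  intro i
  induction i with
  | zero => intro _; exact ⟨rfl, by simp [Eseq]⟩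
  | succ i ih =>
    intro hi
    obtain ⟨hcard, hpot⟩ := ih (by omega)
    obtain ⟨⟨e₀, he₀⟩, hroom⟩ := AltProtocol.room_of_card_le (P.Eseq i) (by omega)
    obtain ⟨hnot, hlt⟩ := P.pot_lt hD (P.Eseq i) he₀ hroom
    refine ⟨?_, ?_⟩
    · show (insert (P.genOut (P.Eseq i)) (P.Eseq i)).card = i + 1
      rw [Finset.card_insert_of_notMem hnot, hcard]
    · show horner (2 * T + 1) (P.dg (insert (P.genOut (P.Eseq i)) (P.Eseq i))) D + (i + 1) ≤ _
      omega

/-- No correct history-dependent protocol all of whose block indices (rounds `< T`, along every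
generic run) are at most `D`, once `(2T+1)^(D+1) + 1` cells fit into the matrix. -/
theorem false_of_hblk_le {D : ℕ} (hD : ∀ (E : Finset (Cell n)), ∀ t < T, P.hblk E t ≤ D)
    (hroom : (2 * T + 1) ^ (D + 1) + 1 ≤ Fintype.card (Cell n)) : False := by
  obtain ⟨-, hpot⟩ := P.Eseq_pot hD ((2 * T + 1) ^ (D + 1)) hroom _ le_rfl
  have hbound := horner_lt (2 * T + 1) (P.dg ∅) (fun v => P.dg_lt ∅ v) D
  omega

/-- **No correct history-dependent protocol with at most `Δ` alternations along every zero pattern**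
once `(2T+1)^(Δ+2) + 1` cells fit into the matrix. -/
theorem false_of_altBound {Δ : ℕ}
    (hΔ : ∀ z : ℕ → Bool, ((Finset.range (T - 1)).filter (fun s =>
      P.owner s (fun j : Fin s => z j) ≠ P.owner (s + 1) (fun j : Fin (s + 1) => z j))).card ≤ Δ)
    (hroom : (2 * T + 1) ^ (Δ + 2) + 1 ≤ Fintype.card (Cell n)) : False :=
  P.false_of_hblk_le (D := Δ + 1) (fun E _ ht => P.hblk_le_of_altBound hΔ E ht) hroom

end HProtocol

end

end Summit.ValiantsHypothesis.ValiantsHypothesis.Theorems.AlgebraicKWGames.OneAlt
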